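import Literature.IUT.HodgeArakelov.GaloisPairCyclotomesThetaSyncThetaSide
import Literature.IUT.HodgeArakelov.GaloisPairRigidityCor111ModulesProofs
import HarnessLib

/-!
# [IUTchII] Cor. 1.11 (b): the residual (C) at Cor. 1.10's genuine family is a condition on OUTER automorphisms
# of `Π^tp_{X̲̲}` — it holds at every inner automorphism, and the compatible automorphisms form a subgroup

Mochizuki, *Inter-universal Teichmüller theory II*, §1, Cor. 1.11 (b), kurims manuscript (Dec. 2020) p. 49
[claim: Mochizuki2012, status: disputed] (IUTchII §1 Cor 1.11, kurims p.49); [AbsTopIII] Cor. 1.10 (c) p. 42 («the natural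
isomorphism `μ_Ẑ(G_k) ⥲ μ_Ẑ(Π_X)`», functorial in arbitrary isomorphisms of topological groups). abc-iut cell, layer L6, node
`IUTchII:Cor1.11`; seat abc-iut-w5-d145 (gen 4); GAP-LEDGER **G-w5d145-2**. PROOF-ONLY, 0 defs.

abc-iut-w5-d145's `EtaleLevels.nonempty_galCorPiXInput_familyLim_iff_compatible` (p432181) identified the `Π`-side residual of
Cor. 1.11 (b) at Cor. 1.10's GENUINE family as (C): every isomorphism `c : μ_Ẑ(Π^tp_{X̲̲}/Δ) ⥲ (l·Δ_Θ)(𝕄_*)` intertwines,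
for every topological automorphism `γ` of `Π^tp_{X̲̲}`, the transport `μ_Ẑ(quotMap γ)` with `ρ_A(γ)`. THIS FILE proves:

* ABSTRACT (any Ex. 1.8 interface `A`, any base datum `X`, any `c`): `AbsTopMonoids.quotMap_conj` — the isomorphism
  `Π/Δ ⥲ Π/Δ` induced by the inner automorphism `conj_x` of `Π` IS `conj_{[x]}`; hence `μ_Ẑ(quotMap conj_x) = [x] • (·)` (the
  cyclotomic character, `galCyclotomeMap_quotMap_conj`); the automorphisms `γ` at which `c` is compatible contain `𝟙`, are
  closed under composition and inverse (`compatibleAt_id/_comp/_inv`), and contain `conj_x` as soon as `c` is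
  `Π`-equivariant and `ρ_A(conj_x) = act_A(x)` (`compatibleAt_conj`);
* GENUINE (Cor. 1.10's family `familyLim` over the [EtTh] model setting): `EtaleLevels.rhoALim_conj` — [EtTh] Cor. 2.18 (i)'s
  transport of the inner automorphism `conj_x` to `(l·Δ_Θ)(𝕄_*)` IS the conjugation action `actIntLim x`; with (E) a THEOREM
  (`exists_equivariant_iso`, p432181) this gives `compatible_conj`: **(C) HOLDS AT EVERY INNER AUTOMORPHISM, for every `c`**;
  `compatible_conj_comp_iff` / `compatible_comp_conj_iff`: (C) at `γ` depends only on the class of `γ` in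
  `Out(Π^tp_{X̲̲}) = Aut/Inn`; `nonempty_galCorPiXInput_familyLim_iff_compatible_on_representatives`: the input
  `GalCorPiXInput A familyLim` of Cor. 1.11 (b) is inhabited iff (C) holds on ANY family of topological automorphisms meeting
  every `Inn(Π^tp_{X̲̲})`-coset.

So the published prerequisite G-w5d145-2 asks for is exactly [AbsTopIII] Cor. 1.10 (c) NATURALITY w.r.t. OUTER automorphisms
of `Π^tp_{X̲̲}` (composed with [EtTh] Cor. 2.19 (i)); nothing here discharges it. No new `Prop` fact; nothing of another seat
restated; nothing here bears on [IUTchIII] Cor. 3.12; typed ≠ discharged.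
-/

noncomputable section

namespace Literature.IUT.HodgeArakelov

open CategoryTheory
open Literature.AnabelianGeometry.AbsoluteAnabelian

universe u

/-! ## §1 Abstract: inner automorphisms of `Π` induce inner automorphisms of `Π/Δ` -/

namespace AbsTopMonoids

variable {S : ThetaSetting.{u}} (A : AbsTopMonoids S)

/-- **`quotMap (conj_x) = conj_{[x]}`**: the isomorphism `Π/Δ ⥲ Π/Δ` INDUCED ([IUTchII] Ex. 1.8 (i)) by the inner automorphism
`conj_x : Π ⥲ Π` is the inner automorphism of `Π/Δ` by the class of `x` (both send `[y]` to `[x y x⁻¹]`).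
[claim: Mochizuki2012, status: disputed] (IUTchII §1 Ex 1.8 (i), kurims pp.35-36) -/
theorem quotMap_conj (P : IsoClass S.PiX) (x : P.G) :
    A.quotMap (show P ⟶ P from conjContinuousMulEquiv x) =
      (show A.quotObj P ⟶ A.quotObj P from conjContinuousMulEquiv (QuotientGroup.mk x : P.G ⧸ A.Delta P)) := by
  apply ContinuousMulEquiv.ext
  intro q
  induction q using QuotientGroup.induction_on with
  | H y => rfl

/-- **`μ_Ẑ(quotMap conj_x) = [x] • (·)`**: applying `μ_Ẑ(−)` to the isomorphism of `Π/Δ` induced by the inner automorphism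
`conj_x` of `Π` gives the `Π/Δ`-module action of `[x]` on `μ_Ẑ(Π/Δ)` — the cyclotomic character through `Π ↠ Π/Δ`
([AbsAnab] Prop. 1.2.1 (vi); abc-iut's `IsoClass.galCyclotomeMap_conj`). [claim: Mochizuki2012, status: disputed]
(IUTchII §1 Cor 1.11, kurims p.49) -/
theorem galCyclotomeMap_quotMap_conj [CompactSpace S.Gk] (P : IsoClass S.PiX) (x : P.G)
    (ζ : (A.quotObj P).galCyclotome) :
    IsoClass.galCyclotomeMap (A.quotMap (show P ⟶ P from conjContinuousMulEquiv x)) ζ =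
      (haveI := (A.quotObj P).compactSpace_carrier; (QuotientGroup.mk x : P.G ⧸ A.Delta P) • ζ) := by
  rw [quotMap_conj]
  exact IsoClass.galCyclotomeMap_conj (A.quotObj P) _ ζ

end AbsTopMonoids

/-! ## §2 Abstract: the automorphisms at which a comparison `c` is compatible form a subgroup containing `Inn(Π)` -/

namespace MonoThetaBaseDatum

variable {S : ThetaSetting.{u}} [CompactSpace S.Gk] (A : AbsTopMonoids S) {P₀ : IsoClass S.PiX}
  (X : MonoThetaBaseDatum S P₀) (c : ↥(A.quotObj P₀).galCyclotome ≃* X.A)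

/-- (C) holds at the identity. [claim: Mochizuki2012, status: disputed] (IUTchII §1 Cor 1.11, kurims p.49) -/
theorem compatibleAt_id (ζ : (A.quotObj P₀).galCyclotome) :
    c (IsoClass.galCyclotomeMap (A.quotMap (𝟙 P₀)) ζ) = X.rhoA (IsoClass.homIso (𝟙 P₀)) (c ζ) := by
  rw [A.quotMap_id, IsoClass.galCyclotomeMap_id, MulEquiv.refl_apply]
  change c ζ = X.rhoA (ContinuousMulEquiv.refl P₀.G) (c ζ)
  rw [X.rhoA_refl, MulEquiv.refl_apply]

/-- (C) is closed under composition: `μ_Ẑ(quotMap −)` and `ρ_A` are both multiplicative.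
[claim: Mochizuki2012, status: disputed] (IUTchII §1 Cor 1.11, kurims p.49) -/
theorem compatibleAt_comp {γ δ : P₀ ⟶ P₀}
    (hγ : ∀ ζ, c (IsoClass.galCyclotomeMap (A.quotMap γ) ζ) = X.rhoA (IsoClass.homIso γ) (c ζ))
    (hδ : ∀ ζ, c (IsoClass.galCyclotomeMap (A.quotMap δ) ζ) = X.rhoA (IsoClass.homIso δ) (c ζ))
    (ζ : (A.quotObj P₀).galCyclotome) :
    c (IsoClass.galCyclotomeMap (A.quotMap (γ ≫ δ)) ζ) = X.rhoA (IsoClass.homIso (γ ≫ δ)) (c ζ) := by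
  rw [A.quotMap_comp, IsoClass.galCyclotomeMap_comp, MulEquiv.trans_apply, hδ, hγ]
  change _ = X.rhoA ((IsoClass.homIso γ).trans (IsoClass.homIso δ)) (c ζ)
  rw [X.rhoA_trans, MulEquiv.trans_apply]

/-- (C) is closed under inverses. [claim: Mochizuki2012, status: disputed] (IUTchII §1 Cor 1.11, kurims p.49) -/
theorem compatibleAt_inv {γ : P₀ ⟶ P₀}
    (hγ : ∀ ζ, c (IsoClass.galCyclotomeMap (A.quotMap γ) ζ) = X.rhoA (IsoClass.homIso γ) (c ζ))
    (ζ : (A.quotObj P₀).galCyclotome) :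
    c (IsoClass.galCyclotomeMap (A.quotMap (inv γ)) ζ) = X.rhoA (IsoClass.homIso (inv γ)) (c ζ) := by
  -- `ζ = μ_Ẑ(quotMap γ) ζ'` with `ζ' := μ_Ẑ(quotMap γ⁻¹) ζ`
  have h1 : IsoClass.galCyclotomeMap (A.quotMap γ) (IsoClass.galCyclotomeMap (A.quotMap (inv γ)) ζ) = ζ := by
    rw [← MulEquiv.trans_apply, ← IsoClass.galCyclotomeMap_comp, ← A.quotMap_comp, IsIso.inv_hom_id, A.quotMap_id,
      IsoClass.galCyclotomeMap_id, MulEquiv.refl_apply]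
  have h2 := hγ (IsoClass.galCyclotomeMap (A.quotMap (inv γ)) ζ)
  rw [h1] at h2
  -- `ρ_A(γ⁻¹) = ρ_A(γ)⁻¹`
  have h3 : inv γ = (show P₀ ⟶ P₀ from (IsoClass.homIso γ).symm) := by
    apply IsIso.inv_eq_of_hom_inv_id
    exact ContinuousMulEquiv.ext fun y => (IsoClass.homIso γ).symm_apply_apply y
  rw [h3] at h2 ⊢
  change _ = X.rhoA (IsoClass.homIso γ).symm (c ζ)
  rw [X.rhoA_symm, h2, MulEquiv.symm_apply_apply]

/-- **(C) at an inner automorphism follows from (E)**: if `c` is `Π₀`-equivariant (condition (E) of the residual) and the base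
datum transports `conj_x` to the action of `x` (`ρ_A(conj_x) = act_A(x)` — automatic for a transport defined by restriction,
cf. `EtaleLevels.rhoALim_conj`), then `c` is compatible with `conj_x`. [claim: Mochizuki2012, status: disputed]
(IUTchII §1 Cor 1.11, kurims p.49) -/
theorem compatibleAt_conj
    (hE : ∀ (x : P₀.G) (ζ : (A.quotObj P₀).galCyclotome),
      c (haveI := (A.quotObj P₀).compactSpace_carrier; (QuotientGroup.mk x : P₀.G ⧸ A.Delta P₀) • ζ) = X.actA x (c ζ))
    (x : P₀.G) (hρ : X.rhoA (conjContinuousMulEquiv x) = (X.actA x : X.A ≃* X.A))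
    (ζ : (A.quotObj P₀).galCyclotome) :
    c (IsoClass.galCyclotomeMap (A.quotMap (show P₀ ⟶ P₀ from conjContinuousMulEquiv x)) ζ) =
      X.rhoA (IsoClass.homIso (show P₀ ⟶ P₀ from conjContinuousMulEquiv x)) (c ζ) := by
  rw [A.galCyclotomeMap_quotMap_conj, hE]
  change _ = X.rhoA (conjContinuousMulEquiv x) (c ζ)
  rw [hρ]

end MonoThetaBaseDatum

/-! ## §3 The genuine family of [IUTchII] Cor. 1.10: (C) holds on `Inn(Π^tp_{X̲̲})` and descends to `Out(Π^tp_{X̲̲})` -/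

namespace EtaleLevels

open Literature.AnabelianGeometry.EtaleTheta Literature.AnabelianGeometry.SemiGraphs
open scoped Literature.AnabelianGeometry.EtaleTheta

variable {p : ℕ} [Fact p.Prime] {D : Literature.AnabelianGeometry.EtaleTheta.ThetaSetting p}
  {E : D.EtaleThetaData} {l : ℕ} (C : E.DoubleUnderline l) (hC : D.Compat) (hS : D.Sec2Hyps)
  (hl : l.Prime) (hp2 : p ≠ 2) (hpl : p ≠ l) (hζ : ∃ ζ : D.K, IsPrimitiveRoot ζ (4 * l))
  (mods : ∀ M : ℕ+, D.CyclotomeMod l M)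
  (f : contCocycles D.toTheta D.DeltaTheta C.GtpYdduu) (hf : f ∈ C.rootCocycles hC)
  (hmods : ∀ (M M' : ℕ+) (h : (M : ℕ) ∣ (M' : ℕ)) (x : D.lDeltaTheta l),
    MuN.red p M M' h ((mods M').red x) = (mods M).red x)
  (h15 : Literature.AnabelianGeometry.EtaleTheta.ThetaSetting.Prop15iii E hC) (L : C.CuspLabels)
  (hZ : ∀ M : ℕ+, Nonempty (ModelCyclotomes.lDeltaQuot (C.rigidData (mods M) hC hS h15 L) ≃*
    Literature.IUT.HodgeTheaters.ZHat))
  (h218i₁ : (levelRigid C hC hS mods h15 L 1).Cor218_i)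

/-- **`ρ_A(conj_x) = act_A(x)` at the genuine natural system**: [EtTh] Cor. 2.18 (i)'s transport of the INNER automorphism
`conj_x` of `Π^tp_{X̲̲}` to `(l·Δ_Θ)(𝕄_*) = (l·Δ_Θ)/thetaKer` (`rhoALim`, restriction of `conj_x` to `l·Δ_Θ`, descended) is the
conjugation action `actIntLim x` ([IUTchII] Def. 1.1 (i)) — both send `[g]` to `[x g x⁻¹]`.
[claim: Mochizuki2012, status: disputed] (IUTchII §1 Cor 1.10, kurims p.47) -/
theorem rhoALim_conj (x : (levelRigid C hC hS mods h15 L 1).PiX) :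
    rhoALim C hC hS mods h15 L h218i₁ (conjContinuousMulEquiv x) = actIntLim C hC hS mods h15 L x := by
  refine MulEquiv.ext fun q => ?_
  induction q using QuotientGroup.induction_on with
  | H g =>
    rw [rhoALim_mk]
    change _ = SubquotientKit.conjQuot (levelRigid C hC hS mods h15 L 1).lDeltaTheta (levelRigid C hC hS mods h15 L 1).thetaKer
      x (QuotientGroup.mk g)
    rw [SubquotientKit.conjQuot_mk]
    exact congrArg QuotientGroup.mk (Subtype.ext (by
      rw [SubquotientKit.coe_restrictEquiv, MulAut.conjNormal_apply]
      rfl))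

/-- The same for the base datum `baseDatumLim` of Cor. 1.10's genuine family (`ρ_A := rhoALim`, `act_A := actIntLim`).
[claim: Mochizuki2012, status: disputed] (IUTchII §1 Cor 1.10, kurims p.47) -/
theorem baseDatumLim_rhoA_conj (x : (basePointLim C hC hS hl hp2 hpl hζ mods f hf hmods h15 L hZ).G) :
    (baseDatumLim C hC hS hl hp2 hpl hζ mods f hf hmods h15 L hZ h218i₁).rhoA (conjContinuousMulEquiv x) =
      ((baseDatumLim C hC hS hl hp2 hpl hζ mods f hf hmods h15 L hZ h218i₁).actA x :
        ↥(baseDatumLim C hC hS hl hp2 hpl hζ mods f hf hmods h15 L hZ h218i₁).A ≃*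
          ↥(baseDatumLim C hC hS hl hp2 hpl hζ mods f hf hmods h15 L hZ h218i₁).A) :=
  rhoALim_conj C hC hS mods h15 L h218i₁ x

variable [CompactSpace (setting C hC hS hl hp2 hpl hζ mods f hf).Gk] (A : AbsTopMonoids (setting C hC hS hl hp2 hpl hζ mods f hf))

/-- **(C) HOLDS AT EVERY INNER AUTOMORPHISM of `Π^tp_{X̲̲}`, for EVERY comparison `c`** (Cor. 1.10's genuine family, any Ex. 1.8
interface `A`): (E) is a theorem there (`exists_equivariant_iso`) and iso-independent (`GalCorPiXInput.equivariant_transfer`),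
`μ_Ẑ(quotMap conj_x)` is the cyclotomic character and `ρ_A(conj_x)` the conjugation action. So the residual (C) of [IUTchII]
Cor. 1.11 (b) (GAP-LEDGER G-w5d145-2) constrains only OUTER automorphisms. [claim: Mochizuki2012, status: disputed]
(IUTchII §1 Cor 1.11, kurims p.49) -/
theorem compatible_conj
    (c : ↥(A.quotObj (basePointLim C hC hS hl hp2 hpl hζ mods f hf hmods h15 L hZ)).galCyclotome ≃*
      (baseDatumLim C hC hS hl hp2 hpl hζ mods f hf hmods h15 L hZ h218i₁).A)
    (x : (basePointLim C hC hS hl hp2 hpl hζ mods f hf hmods h15 L hZ).G)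
    (ζ : (A.quotObj (basePointLim C hC hS hl hp2 hpl hζ mods f hf hmods h15 L hZ)).galCyclotome) :
    c (IsoClass.galCyclotomeMap (A.quotMap (show basePointLim C hC hS hl hp2 hpl hζ mods f hf hmods h15 L hZ ⟶
        basePointLim C hC hS hl hp2 hpl hζ mods f hf hmods h15 L hZ from conjContinuousMulEquiv x)) ζ) =
      (baseDatumLim C hC hS hl hp2 hpl hζ mods f hf hmods h15 L hZ h218i₁).rhoA
        (IsoClass.homIso (show basePointLim C hC hS hl hp2 hpl hζ mods f hf hmods h15 L hZ ⟶
          basePointLim C hC hS hl hp2 hpl hζ mods f hf hmods h15 L hZ from conjContinuousMulEquiv x)) (c ζ) := by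
  have hA := nonempty_baseDatumLim_A_mulEquiv_zHat C hC hS hl hp2 hpl hζ mods f hf hmods h15 L hZ h218i₁
  obtain ⟨c₀, hE₀⟩ := exists_equivariant_iso C hC hS hl hp2 hpl hζ mods f hf hmods h15 L hZ h218i₁ A
  exact MonoThetaBaseDatum.compatibleAt_conj A _ c
    (fun y ξ => GalCorPiXInput.equivariant_transfer A _ hA c₀ c hE₀ y ξ) x
    (baseDatumLim_rhoA_conj C hC hS hl hp2 hpl hζ mods f hf hmods h15 L hZ h218i₁ x) ζ

/-- **(C) descends to `Out(Π^tp_{X̲̲})`, I**: `c` is compatible with `γ` iff it is compatible with `conj_x ≫ γ`.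
[claim: Mochizuki2012, status: disputed] (IUTchII §1 Cor 1.11, kurims p.49) -/
theorem compatible_conj_comp_iff
    (c : ↥(A.quotObj (basePointLim C hC hS hl hp2 hpl hζ mods f hf hmods h15 L hZ)).galCyclotome ≃*
      (baseDatumLim C hC hS hl hp2 hpl hζ mods f hf hmods h15 L hZ h218i₁).A)
    (x : (basePointLim C hC hS hl hp2 hpl hζ mods f hf hmods h15 L hZ).G)
    (γ : basePointLim C hC hS hl hp2 hpl hζ mods f hf hmods h15 L hZ ⟶ basePointLim C hC hS hl hp2 hpl hζ mods f hf hmods h15 L hZ) :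
    (∀ ζ, c (IsoClass.galCyclotomeMap (A.quotMap γ) ζ) =
        (baseDatumLim C hC hS hl hp2 hpl hζ mods f hf hmods h15 L hZ h218i₁).rhoA (IsoClass.homIso γ) (c ζ)) ↔
      ∀ ζ, c (IsoClass.galCyclotomeMap (A.quotMap
          ((show basePointLim C hC hS hl hp2 hpl hζ mods f hf hmods h15 L hZ ⟶
            basePointLim C hC hS hl hp2 hpl hζ mods f hf hmods h15 L hZ from conjContinuousMulEquiv x) ≫ γ)) ζ) =
        (baseDatumLim C hC hS hl hp2 hpl hζ mods f hf hmods h15 L hZ h218i₁).rhoA (IsoClass.homIso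
          ((show basePointLim C hC hS hl hp2 hpl hζ mods f hf hmods h15 L hZ ⟶
            basePointLim C hC hS hl hp2 hpl hζ mods f hf hmods h15 L hZ from conjContinuousMulEquiv x) ≫ γ)) (c ζ) := by
  have hx := compatible_conj C hC hS hl hp2 hpl hζ mods f hf hmods h15 L hZ h218i₁ A c x
  refine ⟨fun hγ => MonoThetaBaseDatum.compatibleAt_comp A _ c hx hγ, fun h => ?_⟩
  -- `γ = conj_{x⁻¹} ≫ (conj_x ≫ γ)`
  have hx' := compatible_conj C hC hS hl hp2 hpl hζ mods f hf hmods h15 L hZ h218i₁ A c x⁻¹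
  have key := MonoThetaBaseDatum.compatibleAt_comp A _ c hx' h
  have hγ : (show basePointLim C hC hS hl hp2 hpl hζ mods f hf hmods h15 L hZ ⟶
        basePointLim C hC hS hl hp2 hpl hζ mods f hf hmods h15 L hZ from conjContinuousMulEquiv x⁻¹) ≫
      ((show basePointLim C hC hS hl hp2 hpl hζ mods f hf hmods h15 L hZ ⟶
        basePointLim C hC hS hl hp2 hpl hζ mods f hf hmods h15 L hZ from conjContinuousMulEquiv x) ≫ γ) = γ := by
    apply ContinuousMulEquiv.ext
    intro y
    change IsoClass.homIso γ (conjContinuousMulEquiv x (conjContinuousMulEquiv x⁻¹ y)) = IsoClass.homIso γ y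
    rw [conjContinuousMulEquiv_apply, conjContinuousMulEquiv_apply]
    congr 1
    group
  rw [hγ] at key
  exact key

/-- **(C) descends to `Out(Π^tp_{X̲̲})`, II**: `c` is compatible with `γ` iff it is compatible with `γ ≫ conj_x`.
[claim: Mochizuki2012, status: disputed] (IUTchII §1 Cor 1.11, kurims p.49) -/
theorem compatible_comp_conj_iff
    (c : ↥(A.quotObj (basePointLim C hC hS hl hp2 hpl hζ mods f hf hmods h15 L hZ)).galCyclotome ≃*
      (baseDatumLim C hC hS hl hp2 hpl hζ mods f hf hmods h15 L hZ h218i₁).A)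
    (x : (basePointLim C hC hS hl hp2 hpl hζ mods f hf hmods h15 L hZ).G)
    (γ : basePointLim C hC hS hl hp2 hpl hζ mods f hf hmods h15 L hZ ⟶ basePointLim C hC hS hl hp2 hpl hζ mods f hf hmods h15 L hZ) :
    (∀ ζ, c (IsoClass.galCyclotomeMap (A.quotMap γ) ζ) =
        (baseDatumLim C hC hS hl hp2 hpl hζ mods f hf hmods h15 L hZ h218i₁).rhoA (IsoClass.homIso γ) (c ζ)) ↔
      ∀ ζ, c (IsoClass.galCyclotomeMap (A.quotMap
          (γ ≫ (show basePointLim C hC hS hl hp2 hpl hζ mods f hf hmods h15 L hZ ⟶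
            basePointLim C hC hS hl hp2 hpl hζ mods f hf hmods h15 L hZ from conjContinuousMulEquiv x))) ζ) =
        (baseDatumLim C hC hS hl hp2 hpl hζ mods f hf hmods h15 L hZ h218i₁).rhoA (IsoClass.homIso
          (γ ≫ (show basePointLim C hC hS hl hp2 hpl hζ mods f hf hmods h15 L hZ ⟶
            basePointLim C hC hS hl hp2 hpl hζ mods f hf hmods h15 L hZ from conjContinuousMulEquiv x))) (c ζ) := by
  have hx := compatible_conj C hC hS hl hp2 hpl hζ mods f hf hmods h15 L hZ h218i₁ A c x
  refine ⟨fun hγ => MonoThetaBaseDatum.compatibleAt_comp A _ c hγ hx, fun h => ?_⟩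
  have hx' := compatible_conj C hC hS hl hp2 hpl hζ mods f hf hmods h15 L hZ h218i₁ A c x⁻¹
  have key := MonoThetaBaseDatum.compatibleAt_comp A _ c h hx'
  have hγ : (γ ≫ (show basePointLim C hC hS hl hp2 hpl hζ mods f hf hmods h15 L hZ ⟶
        basePointLim C hC hS hl hp2 hpl hζ mods f hf hmods h15 L hZ from conjContinuousMulEquiv x)) ≫
      (show basePointLim C hC hS hl hp2 hpl hζ mods f hf hmods h15 L hZ ⟶
        basePointLim C hC hS hl hp2 hpl hζ mods f hf hmods h15 L hZ from conjContinuousMulEquiv x⁻¹) = γ := by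
    apply ContinuousMulEquiv.ext
    intro y
    change conjContinuousMulEquiv x⁻¹ (conjContinuousMulEquiv x (IsoClass.homIso γ y)) = IsoClass.homIso γ y
    rw [conjContinuousMulEquiv_apply, conjContinuousMulEquiv_apply]
    group
  rw [hγ] at key
  exact key

/-- **THE RESIDUAL OF [IUTchII] Cor. 1.11 (b) IS A CONDITION ON `Out(Π^tp_{X̲̲})`**: for every Ex. 1.8 interface `A`, the input
`GalCorPiXInput A familyLim` of Cor. 1.11 (b) at Cor. 1.10's genuine family is inhabited iff, for ANY family `R` of topological
automorphisms of `Π^tp_{X̲̲}` meeting every `Inn(Π^tp_{X̲̲})`-coset, every comparison `c : μ_Ẑ(Π^tp_{X̲̲}/Δ) ⥲ (l·Δ_Θ)(𝕄_*)`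
is compatible with every `R i` — i.e. G-w5d145-2 asks precisely for [AbsTopIII] Cor. 1.10 (c) naturality w.r.t. OUTER
automorphisms (composed with [EtTh] Cor. 2.19 (i)). [claim: Mochizuki2012, status: disputed] (IUTchII §1 Cor 1.11, kurims p.49) -/
theorem nonempty_galCorPiXInput_familyLim_iff_compatible_on_representatives {ι : Type*}
    (R : ι → (basePointLim C hC hS hl hp2 hpl hζ mods f hf hmods h15 L hZ ⟶ basePointLim C hC hS hl hp2 hpl hζ mods f hf hmods h15 L hZ))
    (hR : ∀ γ : basePointLim C hC hS hl hp2 hpl hζ mods f hf hmods h15 L hZ ⟶ basePointLim C hC hS hl hp2 hpl hζ mods f hf hmods h15 L hZ,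
      ∃ (i : ι) (x : (basePointLim C hC hS hl hp2 hpl hζ mods f hf hmods h15 L hZ).G),
        γ = (show basePointLim C hC hS hl hp2 hpl hζ mods f hf hmods h15 L hZ ⟶
          basePointLim C hC hS hl hp2 hpl hζ mods f hf hmods h15 L hZ from conjContinuousMulEquiv x) ≫ R i) :
    Nonempty (GalCorPiXInput A (familyLim C hC hS hl hp2 hpl hζ mods f hf hmods h15 L hZ h218i₁)) ↔
      ∀ (c : ↥(A.quotObj (basePointLim C hC hS hl hp2 hpl hζ mods f hf hmods h15 L hZ)).galCyclotome ≃*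
          (baseDatumLim C hC hS hl hp2 hpl hζ mods f hf hmods h15 L hZ h218i₁).A) (i : ι)
        (ζ : (A.quotObj (basePointLim C hC hS hl hp2 hpl hζ mods f hf hmods h15 L hZ)).galCyclotome),
        c (IsoClass.galCyclotomeMap (A.quotMap (R i)) ζ) =
          (baseDatumLim C hC hS hl hp2 hpl hζ mods f hf hmods h15 L hZ h218i₁).rhoA (IsoClass.homIso (R i)) (c ζ) := by
  rw [nonempty_galCorPiXInput_familyLim_iff_compatible C hC hS hl hp2 hpl hζ mods f hf hmods h15 L hZ h218i₁ A]
  refine ⟨fun h c i ζ => h c (R i) ζ, fun h c γ => ?_⟩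
  obtain ⟨i, x, rfl⟩ := hR γ
  exact (compatible_conj_comp_iff C hC hS hl hp2 hpl hζ mods f hf hmods h15 L hZ h218i₁ A c x (R i)).1 (h c i)

end EtaleLevels

end Literature.IUT.HodgeArakelov

end
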